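import Literature.NumberTheory.Sieve.FGKMT2018MultidimensionalSieve
import HarnessLib

/-!
# FGKMT 2018 Hypothesis 1, parts (1) and (3), for `𝒜 = ℤ`: the dyadic blocks are
well-distributed in every residue class — `|#𝒜(X; q, a) − #𝒜(X)/q| ≤ 1`

Source: K. Ford, B. Green, S. Konyagin, J. Maynard, T. Tao, *Long gaps between primes*, J. Amer.
Math. Soc. 31 (2018), §7 p. 20 («parts (1) and (3) of Hypothesis 1 … in our case 𝒜 = ℤ» are
automatic) [FordGreenKonyaginMaynardTao2018]; J. Maynard, *Dense clusters of primes in subsets*,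
Compositio Math. 152 (2016), Hypothesis 1 p. 4 [Maynard2016DenseClusters].

For the set `𝒜 = ℤ` and the block `𝒜(X) = {n ∈ ℤ : X ≤ n ≤ 2X} = dyadZ X`, the number of
`n ∈ 𝒜(X)` with `n ≡ a (mod q)` differs from `#𝒜(X)/q` by at most `1`, uniformly in `q ≥ 1`,
`a` and `X` (theorems only):

* `abs_card_dyadZ_modEq_sub_div_le` — `|#𝒜(X; q, a) − #𝒜(X)/q| ≤ 1` (Hypothesis 1 (1) for
  `ℤ` with level of distribution `1`: summing over `q ≤ Q` gives `≤ Q`);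
* `card_dyadZ_modEq_le_div_add_one`, `div_sub_one_le_card_dyadZ_modEq` — the one-sided forms;
* `card_dyadZ_modEq_le_two_mul_div` — `#𝒜(X; q, a) ≤ 2 #𝒜(X)/q` once `q ≤ #𝒜(X)`
  (Hypothesis 1 (3) for `ℤ`);
* `sum_abs_card_dyadZ_modEq_sub_div_le` — `∑_{q ∈ S} |#𝒜(X; q, a_q) − #𝒜(X)/q| ≤ #S` for any
  finite set `S` of positive moduli and any choice of residues.

## References
* [FordGreenKonyaginMaynardTao2018] §7 p. 20 (Hypothesis 1 for 𝒜 = ℤ).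
* [Maynard2016DenseClusters] Hypothesis 1 p. 4.
-/

noncomputable section

open Finset

namespace Literature.NumberTheory.Sieve.FGKMT2018

/-- **`|#𝒜(X; q, a) − #𝒜(X)/q| ≤ 1`** for `𝒜 = ℤ`: the integers of `[X, 2X]` in the class
`a (mod q)`, `q ≥ 1`, number `#𝒜(X)/q + O(1)` with `|O(1)| ≤ 1`.
[cite: FordGreenKonyaginMaynardTao2018, §7 p. 20 (Hypothesis 1 (1),(3) for 𝒜 = ℤ)] -/
theorem abs_card_dyadZ_modEq_sub_div_le (X : ℝ) {q : ℕ} (hq : 0 < q) (a : ℤ) :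
    |(#((dyadZ X).filter fun n : ℤ => n ≡ a [ZMOD (q : ℤ)]) : ℝ) - (#(dyadZ X) : ℝ) / q| ≤ 1 := by
  classical
  unfold dyadZ
  set A : ℤ := ⌈X⌉ with hA
  set B : ℤ := ⌊2 * X⌋ with hB
  rcases lt_or_ge B A with hBA | hAB
  · rw [Finset.Icc_eq_empty_of_lt hBA]
    simp
  · have hIcc : Finset.Icc A B = Finset.Ioc (A - 1) B := by
      ext n; simp only [Finset.mem_Icc, Finset.mem_Ioc]; omega
    have hqZ : (0 : ℤ) < (q : ℤ) := by exact_mod_cast hq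
    have hqQ : (0 : ℚ) < (q : ℚ) := by exact_mod_cast hq
    rw [hIcc]
    have hc : ((#((Finset.Ioc (A - 1) B).filter fun n : ℤ => n ≡ a [ZMOD (q : ℤ)]) : ℕ) : ℤ)
        = ⌊((B : ℚ) - a) / q⌋ - ⌊((A : ℚ) - 1 - a) / q⌋ := by
      have h := Int.Ioc_filter_modEq_card (A - 1) B hqZ a
      rw [max_eq_left] at h
      · push_cast at h ⊢
        linarith [h]
      · refine sub_nonneg.mpr (Int.floor_le_floor (div_le_div_of_nonneg_right ?_ hqQ.le))
        push_cast
        have : (A : ℚ) ≤ B := by exact_mod_cast hAB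
        linarith
    have hN : (((B - (A - 1)).toNat : ℕ) : ℝ) = (B : ℝ) - A + 1 := by
      have : (((B - (A - 1)).toNat : ℕ) : ℤ) = B - A + 1 := by
        rw [Int.toNat_of_nonneg (by omega)]; ring
      exact_mod_cast this
    have hFQ : |(((⌊((B : ℚ) - a) / q⌋ - ⌊((A : ℚ) - 1 - a) / q⌋ : ℤ)) : ℚ)
        - ((B : ℚ) - A + 1) / q| ≤ 1 := by
      have h1 := Int.floor_le (((B : ℚ) - a) / q)
      have h2 := Int.lt_floor_add_one (((B : ℚ) - a) / q)
      have h3 := Int.floor_le (((A : ℚ) - 1 - a) / q)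
      have h4 := Int.lt_floor_add_one (((A : ℚ) - 1 - a) / q)
      have e : ((B : ℚ) - A + 1) / q = ((B : ℚ) - a) / q - ((A : ℚ) - 1 - a) / q := by
        field_simp
        ring
      rw [e, abs_le]
      push_cast
      constructor <;> linarith
    have hR : ((#((Finset.Ioc (A - 1) B).filter fun n : ℤ => n ≡ a [ZMOD (q : ℤ)]) : ℕ) : ℝ)
        = (((⌊((B : ℚ) - a) / q⌋ - ⌊((A : ℚ) - 1 - a) / q⌋ : ℤ)) : ℝ) := by
      exact_mod_cast hc
    rw [Int.card_Ioc, hN, hR]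
    have := (Rat.cast_le (K := ℝ)).mpr hFQ
    push_cast at this ⊢
    exact this

/-- `#𝒜(X; q, a) ≤ #𝒜(X)/q + 1` (`𝒜 = ℤ`, `q ≥ 1`).
[cite: FordGreenKonyaginMaynardTao2018, §7 p. 20 (Hypothesis 1 (3) for 𝒜 = ℤ)] -/
theorem card_dyadZ_modEq_le_div_add_one (X : ℝ) {q : ℕ} (hq : 0 < q) (a : ℤ) :
    (#((dyadZ X).filter fun n : ℤ => n ≡ a [ZMOD (q : ℤ)]) : ℝ) ≤ (#(dyadZ X) : ℝ) / q + 1 := by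
  have := (abs_le.mp (abs_card_dyadZ_modEq_sub_div_le X hq a)).2
  linarith

/-- `#𝒜(X)/q − 1 ≤ #𝒜(X; q, a)` (`𝒜 = ℤ`, `q ≥ 1`).
[cite: FordGreenKonyaginMaynardTao2018, §7 p. 20 (Hypothesis 1 (1) for 𝒜 = ℤ)] -/
theorem div_sub_one_le_card_dyadZ_modEq (X : ℝ) {q : ℕ} (hq : 0 < q) (a : ℤ) :
    (#(dyadZ X) : ℝ) / q - 1 ≤ (#((dyadZ X).filter fun n : ℤ => n ≡ a [ZMOD (q : ℤ)]) : ℝ) := by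
  have := (abs_le.mp (abs_card_dyadZ_modEq_sub_div_le X hq a)).1
  linarith

/-- **Hypothesis 1 (3) for `𝒜 = ℤ`**: `#𝒜(X; q, a) ≤ 2 #𝒜(X)/q` whenever `1 ≤ q ≤ #𝒜(X)`.
[cite: FordGreenKonyaginMaynardTao2018, §7 p. 20 (Hypothesis 1 (3) for 𝒜 = ℤ); Maynard2016DenseClusters, Hypothesis 1 p. 4] -/
theorem card_dyadZ_modEq_le_two_mul_div (X : ℝ) {q : ℕ} (hq : 0 < q)
    (hqA : (q : ℝ) ≤ #(dyadZ X)) (a : ℤ) :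
    (#((dyadZ X).filter fun n : ℤ => n ≡ a [ZMOD (q : ℤ)]) : ℝ) ≤ 2 * (#(dyadZ X) : ℝ) / q := by
  have h1 := card_dyadZ_modEq_le_div_add_one X hq a
  have hq' : (0 : ℝ) < q := by exact_mod_cast hq
  have h2 : (1 : ℝ) ≤ (#(dyadZ X) : ℝ) / q := by rwa [le_div_iff₀ hq', one_mul]
  have e : 2 * (#(dyadZ X) : ℝ) / q = 2 * ((#(dyadZ X) : ℝ) / q) := by ring
  rw [e]
  linarith

/-- **Hypothesis 1 (1) for `𝒜 = ℤ`** (summed form): for any finite set `S` of positive moduli and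
any choice of residues `a_q`, `∑_{q ∈ S} |#𝒜(X; q, a_q) − #𝒜(X)/q| ≤ #S`; with `S = {q ≤ X^θ}`
this is `≪ #𝒜(X)/log^{100k²} X` for every `θ < 1`.
[cite: FordGreenKonyaginMaynardTao2018, §7 p. 20 (Hypothesis 1 (1) for 𝒜 = ℤ); Maynard2016DenseClusters, Hypothesis 1 p. 4] -/
theorem sum_abs_card_dyadZ_modEq_sub_div_le (X : ℝ) (S : Finset ℕ) (hS : ∀ q ∈ S, 0 < q)
    (a : ℕ → ℤ) :
    ∑ q ∈ S, |(#((dyadZ X).filter fun n : ℤ => n ≡ a q [ZMOD (q : ℤ)]) : ℝ) - (#(dyadZ X) : ℝ) / q|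
      ≤ #S := by
  calc ∑ q ∈ S, |(#((dyadZ X).filter fun n : ℤ => n ≡ a q [ZMOD (q : ℤ)]) : ℝ)
          - (#(dyadZ X) : ℝ) / q|
      ≤ ∑ q ∈ S, (1 : ℝ) :=
        Finset.sum_le_sum fun q hq => abs_card_dyadZ_modEq_sub_div_le X (hS q hq) (a q)
    _ = #S := by simp

end Literature.NumberTheory.Sieve.FGKMT2018
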